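import Summits.CriticalPhenomena.PercolationContinuityZ3.Theorems.PercNearOneGluingNoHeavyLowerTailKNGoodGMgcBexpTools
import Summits.CriticalPhenomena.PercolationContinuityZ3.Theorems.PercNearOneGluingAdditiveGluingOneBond
import HarnessLib

/-!
# Side decomposition: a product-Bernoulli probability as a Bernoulli expectation over the states of finitely many edges
# (`NoHeavyLowerTail` cell, stmt-CriticalPhenomena-4575; prover `prim-hp-2`, gen 17 — first bricks L1/L2 of the semantic layer, memo MEMO-gen17 §4')

Support file (`--supports stmt-CriticalPhenomena-4575`).  Two small definitions (`bexpR`, `force`), no named facts, no sorries.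
* `bexpR n F x` — the real-integrand twin of `KNGoodGMgc.bexp` (same recursion: law of total probability in the last bit); `bexpR_intCast`
  (`bexpR` of an integer integrand is `bexp`), `bexpR_add`, `bexpR_mul_const`, `bexpR_congr`, `bexpR_congr_weights`.
* `force w e m c` — the weights `w` with the enumerated edges `e 0, …, e (m-1)` forced open/closed according to the configuration `c`.
* **`real_eq_bexpR_force`** — for pairwise distinct `e 0, …, e (m-1)` and every event `S`:
  `μ_w(S) = bexpR m (fun c => μ_{force w e m c}(S)) (fun k => w (e k))` — `m` applications of the one-bond decomposition
  `stub_oneBondDecomp_k15`.  With `e` = the twelve side edges of THEOREM B's `K` (bit order of `…KNGoodGMgcCert`) this is the bridge from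
  `prodBernoulli` to the certificate layer's `bexp`/`worldQ`/`phiCoef`: it remains to evaluate the forced (deterministic-side) probabilities
  (memo §4' L3: a forced side glues its world `sideWorld c` onto the core) and to regroup with `bexpR_add`/`bexpR_mul_const`/`bexpR_intCast`.
-/

noncomputable section

namespace Summit.CriticalPhenomena.PercolationContinuityZ3.Theorems

namespace KNGoodGMgc

open MeasureTheory Literature.Probability.LatticeModels Literature.Probability.Percolation

variable {n : ℕ}

/-! ## Real-integrand Bernoulli expectations -/

/-- Expectation of a REAL function of independent bits `C_i ~ Bernoulli(x i)`, `i < m` (bits `≥ m` read `false`), by the same recursion as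
`bexp`. [folklore] -/
noncomputable def bexpR : (m : ℕ) → (Cfg → ℝ) → (ℕ → ℝ) → ℝ
  | 0, F, _ => F fun _ => false
  | m + 1, F, x => (1 - x m) * bexpR m (fun c => F (Function.update c m false)) x +
      x m * bexpR m (fun c => F (Function.update c m true)) x

/-- `bexpR` with no bits. [folklore] -/
theorem bexpR_zero (F : Cfg → ℝ) (x : ℕ → ℝ) : bexpR 0 F x = F fun _ => false := rfl
/-- `bexpR`: conditioning on the last bit. [folklore] -/
theorem bexpR_succ (m : ℕ) (F : Cfg → ℝ) (x : ℕ → ℝ) :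
    bexpR (m + 1) F x = (1 - x m) * bexpR m (fun c => F (Function.update c m false)) x +
      x m * bexpR m (fun c => F (Function.update c m true)) x := rfl

/-- `bexpR` of an integer integrand is `bexp`. [folklore] -/
theorem bexpR_intCast : ∀ (m : ℕ) (f : Cfg → ℤ) (x : ℕ → ℝ), bexpR m (fun c => (f c : ℝ)) x = bexp m f x
  | 0, f, x => by rw [bexpR_zero, bexp_zero]
  | m + 1, f, x => by
    rw [bexpR_succ, bexp_succ, ← bexpR_intCast m, ← bexpR_intCast m]

/-- `bexpR` is additive. [folklore] -/
theorem bexpR_add : ∀ (m : ℕ) (F G : Cfg → ℝ) (x : ℕ → ℝ), bexpR m (fun c => F c + G c) x = bexpR m F x + bexpR m G x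
  | 0, F, G, x => by simp [bexpR_zero]
  | m + 1, F, G, x => by rw [bexpR_succ, bexpR_succ, bexpR_succ, bexpR_add m, bexpR_add m]; ring

/-- A constant factor comes out of `bexpR`. [folklore] -/
theorem bexpR_mul_const : ∀ (m : ℕ) (F : Cfg → ℝ) (v : ℝ) (x : ℕ → ℝ), bexpR m (fun c => F c * v) x = bexpR m F x * v
  | 0, F, v, x => by simp [bexpR_zero]
  | m + 1, F, v, x => by rw [bexpR_succ, bexpR_succ, bexpR_mul_const m, bexpR_mul_const m]; ring

/-- Pointwise equal integrands. [folklore] -/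
theorem bexpR_congr (m : ℕ) {F G : Cfg → ℝ} (h : ∀ c, F c = G c) (x : ℕ → ℝ) : bexpR m F x = bexpR m G x := by
  rw [show F = G from funext h]

/-- `bexpR m` reads only the weights below `m`. [folklore] -/
theorem bexpR_congr_weights : ∀ (m : ℕ) (F : Cfg → ℝ) (x x' : ℕ → ℝ), (∀ k, k < m → x k = x' k) → bexpR m F x = bexpR m F x'
  | 0, F, x, x', _ => rfl
  | m + 1, F, x, x', h => by
    rw [bexpR_succ, bexpR_succ, h m (Nat.lt_succ_self m),
      bexpR_congr_weights m _ x x' (fun k hk => h k (Nat.lt_succ_of_lt hk)),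
      bexpR_congr_weights m _ x x' (fun k hk => h k (Nat.lt_succ_of_lt hk))]

/-! ## Forcing finitely many edges -/

/-- The weights `w` with the edges `e 0, …, e (m-1)` forced to `1`/`0` according to `c 0, …, c (m-1)`. [folklore] -/
def force (w : Sym2 (Fin n) → unitInterval) (e : ℕ → Sym2 (Fin n)) : ℕ → Cfg → (Sym2 (Fin n) → unitInterval)
  | 0, _ => w
  | m + 1, c => Function.update (force w e m c) (e m) (if c m then 1 else 0)

/-- `force … m` reads only the bits below `m`. [folklore] -/
theorem force_congr (w : Sym2 (Fin n) → unitInterval) (e : ℕ → Sym2 (Fin n)) :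
    ∀ (m : ℕ) (c c' : Cfg), (∀ k, k < m → c k = c' k) → force w e m c = force w e m c'
  | 0, _, _, _ => rfl
  | m + 1, c, c', h => by
    simp only [force]
    rw [force_congr w e m c c' (fun k hk => h k (Nat.lt_succ_of_lt hk)), h m (Nat.lt_succ_self m)]

/-- Forcing commutes with presetting a later (distinct) edge. [folklore] -/
theorem force_update (e : ℕ → Sym2 (Fin n)) :
    ∀ (m : ℕ) (w : Sym2 (Fin n) → unitInterval) (c : Cfg) (f : Sym2 (Fin n)) (v : unitInterval),
      (∀ k, k < m → e k ≠ f) → force (Function.update w f v) e m c = Function.update (force w e m c) f v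
  | 0, _, _, _, _, _ => rfl
  | m + 1, w, c, f, v, h => by
    simp only [force]
    rw [force_update e m w c f v (fun k hk => h k (Nat.lt_succ_of_lt hk)),
      Function.update_comm (h m (Nat.lt_succ_self m))]

/-- **Side decomposition.**  For pairwise distinct edges `e 0, …, e (m-1)` and every event `S`:
`μ_w(S) = bexpR m (fun c => μ_{force w e m c}(S)) (fun k => w (e k))` — the one-bond decomposition iterated. [folklore] -/
theorem real_eq_bexpR_force (S : Set (BondConfig (Fin n))) (e : ℕ → Sym2 (Fin n)) :
    ∀ (m : ℕ), (∀ i j, i < m → j < m → i ≠ j → e i ≠ e j) → ∀ w : Sym2 (Fin n) → unitInterval,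
      (prodBernoulli w).real S = bexpR m (fun c => (prodBernoulli (force w e m c)).real S) (fun k => (w (e k) : ℝ))
  | 0, _, w => rfl
  | m + 1, hinj, w => by
    have hinj' : ∀ i j, i < m → j < m → i ≠ j → e i ≠ e j :=
      fun i j hi hj hij => hinj i j (Nat.lt_succ_of_lt hi) (Nat.lt_succ_of_lt hj) hij
    have hlast : ∀ k, k < m → e k ≠ e m := fun k hk => hinj k m (Nat.lt_succ_of_lt hk) (Nat.lt_succ_self m) (Nat.ne_of_lt hk)
    -- peel the last edge
    have hstep : ∀ (b : Bool) (v : unitInterval) (c : Cfg), (if b then (1 : unitInterval) else 0) = v →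
        force w e (m + 1) (Function.update c m b) = force (Function.update w (e m) v) e m c := by
      intro b v c hv
      show Function.update (force w e m (Function.update c m b)) (e m) (if Function.update c m b m then 1 else 0) = _
      rw [Function.update_self, hv, force_congr w e m (Function.update c m b) c
        (fun k hk => by simp [Function.update_of_ne (Nat.ne_of_lt hk)]), force_update e m w c (e m) v hlast]
    have hstep0 : ∀ c : Cfg, force w e (m + 1) (Function.update c m false) = force (Function.update w (e m) 0) e m c :=
      fun c => hstep false 0 c (by simp)
    have hstep1 : ∀ c : Cfg, force w e (m + 1) (Function.update c m true) = force (Function.update w (e m) 1) e m c :=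
      fun c => hstep true 1 c (by simp)
    rw [bexpR_succ]
    simp only [hstep0, hstep1]
    have hw : ∀ (v : unitInterval), ∀ k, k < m →
        ((Function.update w (e m) v) (e k) : ℝ) = (w (e k) : ℝ) := fun v k hk => by
      rw [Function.update_of_ne (hlast k hk)]
    rw [← bexpR_congr_weights m _ _ _ (hw 0), ← bexpR_congr_weights m _ _ _ (hw 1),
      ← real_eq_bexpR_force S e m hinj' (Function.update w (e m) 0),
      ← real_eq_bexpR_force S e m hinj' (Function.update w (e m) 1)]
    exact stub_oneBondDecomp_k15 n w (e m) S

end KNGoodGMgc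

end Summit.CriticalPhenomena.PercolationContinuityZ3.Theorems
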